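import Summits.Ventures.PercRepro.S1CoreCapSpecFour
import Mathlib.Combinatorics.Enumerative.DoubleCounting

/-!
# PercRepro — AT MOST EIGHT 3-POINT LINES AT NULLITY `4` (p1, gen 23; towards `Q*(4) = 8`)

A configuration of 3-point lines that satisfies the cost clause at nullity `4` has at most `8` lines
(`card_le_eight_of_three_points`). The five-line clause says: if `D` is not inside the union `U` of three lines
`A, B, C`, every further line lies in `U ∪ D` (`subset_of_free`; the ordering `A, B, C, D, E` costs `1 + 1 + 1 + 1`
before `E`). Hence all lines lie in a set `P` of at most `12` points, and `3·#lines = Σ_{u ∈ P} deg u`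
(`three_mul_card_eq_sum_deg`, double counting) with `2·deg u + 1 ≤ #P` (`two_mul_deg_add_one_le`: the lines
through `u` are pairwise disjoint off `u`). If every degree is `≤ 2` this gives `3·#lines ≤ 24`. Otherwise take
three lines through a point `v` (`#U = 7`): with two lines not inside `U` they share their single point off `U`,
so `#P ≤ 8`, every degree is `≤ 3` and `3·#lines ≤ 24`; with at most one line not inside `U`, every other line is
a transversal of the six points `U ∖ {v}`, of which there are at most `4` (`3·#T ≤ 2·6`). Axioms: standard.
-/

namespace PercRepro

namespace S1

namespace FourCap

variable {β : Type} [DecidableEq β]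

/-- **Double counting**: for a family of 3-point lines inside `P`, `3·#S = Σ_{u ∈ P} #{L ∈ S | u ∈ L}`. -/
theorem three_mul_card_eq_sum_deg (S : Finset (Finset β)) (P : Finset β)
    (hS : ∀ L ∈ S, L.card = 3 ∧ L ⊆ P) :
    3 * S.card = ∑ u ∈ P, (S.filter (fun L => u ∈ L)).card := by
  have h := Finset.sum_card_bipartiteAbove_eq_sum_card_bipartiteBelow
    (r := fun (L : Finset β) (u : β) => u ∈ L) (s := S) (t := P)
  have hl : ∀ L ∈ S, (P.bipartiteAbove (fun (L : Finset β) (u : β) => u ∈ L) L).card = 3 := by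
    intro L hL
    have : P.bipartiteAbove (fun (L : Finset β) (u : β) => u ∈ L) L = L := by
      ext u
      simp only [Finset.mem_bipartiteAbove]
      exact ⟨fun h => h.2, fun h => ⟨(hS L hL).2 h, h⟩⟩
    rw [this]
    exact (hS L hL).1
  rw [Finset.sum_congr rfl hl, Finset.sum_const_nat (fun _ _ => rfl), mul_comm] at h
  rw [h]
  rfl

/-- The double count with a uniform degree bound: `3·#S ≤ k·#P`. -/
theorem three_mul_card_le (S : Finset (Finset β)) (P : Finset β) (k : ℕ)
    (hS : ∀ L ∈ S, L.card = 3 ∧ L ⊆ P) (hdeg : ∀ u ∈ P, (S.filter (fun L => u ∈ L)).card ≤ k) :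
    3 * S.card ≤ k * P.card := by
  rw [three_mul_card_eq_sum_deg S P hS]
  calc ∑ u ∈ P, (S.filter (fun L => u ∈ L)).card ≤ ∑ u ∈ P, k := Finset.sum_le_sum hdeg
    _ = k * P.card := by rw [Finset.sum_const_nat (fun _ _ => rfl), mul_comm]

/-- **The degree bound**: 3-point lines through `u` inside `P`, meeting pairwise in `≤ 1` point, are pairwise
disjoint off `u`, so `2·(their number) + 1 ≤ #P`. -/
theorem two_mul_deg_add_one_le (S : Finset (Finset β)) (P : Finset β) (u : β) (hu : u ∈ P)
    (hS : ∀ L ∈ S, L.card = 3 ∧ L ⊆ P)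
    (hS3 : ∀ L ∈ S, ∀ L' ∈ S, L ≠ L' → (L ∩ L').card ≤ 1) :
    2 * (S.filter (fun L => u ∈ L)).card + 1 ≤ P.card := by
  set T := S.filter (fun L => u ∈ L) with hT
  have hmem : ∀ L ∈ T, L ∈ S ∧ u ∈ L := fun L hL => Finset.mem_filter.1 hL
  have hdisj : (T : Set (Finset β)).PairwiseDisjoint (fun L => L.erase u) := by
    intro L hL L' hL' hne
    show Disjoint (L.erase u) (L'.erase u)
    rw [Finset.disjoint_left]
    intro x hx hx'
    rw [Finset.mem_erase] at hx hx'
    have hsub : ({x, u} : Finset β) ⊆ L ∩ L' := by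
      intro y hy
      simp only [Finset.mem_insert, Finset.mem_singleton] at hy
      rcases hy with rfl | rfl
      · exact Finset.mem_inter.2 ⟨hx.2, hx'.2⟩
      · exact Finset.mem_inter.2 ⟨(hmem L hL).2, (hmem L' hL').2⟩
    have h2 := Finset.card_le_card hsub
    rw [Finset.card_pair hx.1] at h2
    have := hS3 L (hmem L hL).1 L' (hmem L' hL').1 hne
    omega
  have hcard : (T.biUnion (fun L => L.erase u)).card = ∑ L ∈ T, (L.erase u).card :=
    Finset.card_biUnion hdisj
  have hsub : T.biUnion (fun L => L.erase u) ⊆ P.erase u := by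
    intro x hx
    rw [Finset.mem_biUnion] at hx
    obtain ⟨L, hL, hxL⟩ := hx
    rw [Finset.mem_erase] at hxL ⊢
    exact ⟨hxL.1, (hS L (hmem L hL).1).2 hxL.2⟩
  have hle := Finset.card_le_card hsub
  rw [Finset.card_erase_of_mem hu] at hle
  have hsum : ∑ L ∈ T, (L.erase u).card = 2 * T.card := by
    rw [Finset.sum_congr rfl (fun L hL => by
      rw [Finset.card_erase_of_mem (hmem L hL).2, (hS L (hmem L hL).1).1])]
    rw [Finset.sum_const_nat (fun _ _ => rfl), mul_comm]
  have hP : 1 ≤ P.card := Finset.card_pos.2 ⟨u, hu⟩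
  omega

section Simple

variable {w : β → ℕ} {ls : Finset (Finset β)}
  (h1 : ∀ L ∈ ls, ∀ v ∈ L, w v = 1 ∨ w v = 2)
  (hcard : ∀ L ∈ ls, L.card = 3)
  (h3 : ∀ L ∈ ls, ∀ L' ∈ ls, L ≠ L' → (L ∩ L').card ≤ 1)
  (h4 : ∀ l : List (Finset β), l.Nodup → (∀ L ∈ l, L ∈ ls) → wsum w (unionL l) ≤ 4 + lineRank l)

include h1 hcard h3 h4

/-- **The five-line clause**: if `D` has a point off `A ∪ B ∪ C`, every further line `E` lies in `A ∪ B ∪ C ∪ D`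
(the ordering `A, B, C, D, E` costs `1 + 1 + 1 + 1` before `E`). -/
theorem subset_of_free {A B C D E : Finset β} (hA : A ∈ ls) (hB : B ∈ ls) (hC : C ∈ ls) (hD : D ∈ ls)
    (hE : E ∈ ls) (hBA : B ≠ A) (hCA : C ≠ A) (hCB : C ≠ B) (hDA : D ≠ A) (hDB : D ≠ B) (hDC : D ≠ C)
    (hEA : E ≠ A) (hEB : E ≠ B) (hEC : E ≠ C) (hED : E ≠ D)
    (hfree : ∃ v ∈ D, v ∉ A ∧ v ∉ B ∧ v ∉ C) : ∀ v ∈ E, v ∈ D ∨ v ∈ C ∨ v ∈ B ∨ v ∈ A := by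
  have hw : ∀ L ∈ ls, ∀ v ∈ L, 1 ≤ w v := fun L hL v hv => by rcases h1 L hL v hv with h | h <;> omega
  have hc := h4 [E, D, C, B, A] (by simp [hBA, hCA, hCB, hDA, hDB, hDC, hEA, hEB, hEC, hED])
    (by simp [hA, hB, hC, hD, hE])
  obtain ⟨a1, b1, c1, d1⟩ := cost_step w A [] (hw A hA)
  obtain ⟨a2, b2, c2, d2⟩ := cost_step w B [A] (hw B hB)
  obtain ⟨a3, b3, c3, d3⟩ := cost_step w C [B, A] (hw C hC)
  obtain ⟨a4, b4, c4, d4⟩ := cost_step w D [C, B, A] (hw D hD)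
  obtain ⟨a5, b5, c5, d5⟩ := cost_step w E [D, C, B, A] (hw E hE)
  obtain ⟨e0, e1, e2, e3⟩ := cost_start w A
  have i2 : (B ∩ unionL [A]).card ≤ 1 := by
    simp only [unionL, Finset.union_empty]
    exact h3 B hB A hA hBA
  have i3 : (C ∩ unionL [B, A]).card ≤ 2 := by
    simp only [unionL, Finset.union_empty]
    rw [Finset.inter_union_distrib_left]
    refine (Finset.card_union_le _ _).trans ?_
    have := h3 C hC B hB hCB
    have := h3 C hC A hA hCA
    omega
  have i4 : 1 ≤ (D \ unionL [C, B, A]).card := by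
    obtain ⟨v, hvD, hvA, hvB, hvC⟩ := hfree
    refine Finset.card_pos.2 ⟨v, Finset.mem_sdiff.2 ⟨hvD, ?_⟩⟩
    rw [mem_unionL_iff]
    simp [hvA, hvB, hvC]
  have kA := hcard A hA
  have kB := hcard B hB
  have kC := hcard C hC
  have kD := hcard D hD
  have kE := hcard E hE
  have hzero : (E \ unionL [D, C, B, A]).card = 0 := by omega
  have hsub : E ⊆ unionL [D, C, B, A] := Finset.sdiff_eq_empty_iff_subset.1 (Finset.card_eq_zero.1 hzero)
  intro v hv
  have h := hsub hv
  rw [mem_unionL_iff] at h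
  simpa using h

/-- With `D` not inside `A ∪ B ∪ C`, every line of the configuration lies in `A ∪ B ∪ C ∪ D`. -/
theorem all_subset_of_free {A B C D : Finset β} (hA : A ∈ ls) (hB : B ∈ ls) (hC : C ∈ ls) (hD : D ∈ ls)
    (hBA : B ≠ A) (hCA : C ≠ A) (hCB : C ≠ B) (hDf : ¬ D ⊆ A ∪ B ∪ C) :
    ∀ X ∈ ls, X ⊆ A ∪ B ∪ C ∪ D := by
  have hDA : D ≠ A := fun h => hDf (h ▸ Finset.subset_union_left.trans Finset.subset_union_left)
  have hDB : D ≠ B := fun h => hDf (h ▸ Finset.subset_union_right.trans Finset.subset_union_left)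
  have hDC : D ≠ C := fun h => hDf (h ▸ Finset.subset_union_right)
  have hfree : ∃ v ∈ D, v ∉ A ∧ v ∉ B ∧ v ∉ C := by
    by_contra hno
    push Not at hno
    exact hDf (fun v hv => by
      simp only [Finset.mem_union]
      by_cases hvA : v ∈ A
      · exact Or.inl (Or.inl hvA)
      by_cases hvB : v ∈ B
      · exact Or.inl (Or.inr hvB)
      · exact Or.inr (hno v hv hvA hvB))
  intro X hX
  by_cases hXA : X = A
  · subst hXA; exact Finset.subset_union_left.trans (Finset.subset_union_left.trans Finset.subset_union_left)
  by_cases hXB : X = B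
  · subst hXB; exact Finset.subset_union_right.trans (Finset.subset_union_left.trans Finset.subset_union_left)
  by_cases hXC : X = C
  · subst hXC; exact Finset.subset_union_right.trans Finset.subset_union_left
  by_cases hXD : X = D
  · subst hXD; exact Finset.subset_union_right
  intro v hv
  have h := subset_of_free h1 hcard h3 h4 hA hB hC hD hX hBA hCA hCB hDA hDB hDC hXA hXB hXC hXD hfree v hv
  simp only [Finset.mem_union]
  tauto

/-- **At most eight 3-point lines** at nullity `4`. -/
theorem card_le_eight_of_three_points : ls.card ≤ 8 := by
  by_contra hlt
  push Not at hlt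
  -- a set `P` containing every line, of at most `12` points, from any three lines and one free line
  have hP12 : ∃ P : Finset β, P.card ≤ 12 ∧ ∀ X ∈ ls, X ⊆ P := by
    obtain ⟨A, B, C, hA, hB, hC, hAB, hAC, hBC⟩ := Finset.two_lt_card_iff.1 (by omega : 2 < ls.card)
    have hU : (A ∪ B ∪ C).card ≤ 9 := by
      have := Finset.card_union_le (A ∪ B) C
      have := Finset.card_union_le A B
      have := hcard A hA; have := hcard B hB; have := hcard C hC
      omega
    by_cases hF : ∃ D ∈ ls, ¬ D ⊆ A ∪ B ∪ C
    · obtain ⟨D, hD, hDf⟩ := hF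
      refine ⟨A ∪ B ∪ C ∪ D, ?_, all_subset_of_free h1 hcard h3 h4 hA hB hC hD hAB.symm hAC.symm hBC.symm hDf⟩
      have := Finset.card_union_le (A ∪ B ∪ C) D
      have := hcard D hD
      omega
    · push Not at hF
      exact ⟨A ∪ B ∪ C, by omega, hF⟩
  by_cases hdeg : ∃ v, 3 ≤ (ls.filter (fun L => v ∈ L)).card
  · -- a point of degree `≥ 3`: three lines through it
    obtain ⟨v, hv⟩ := hdeg
    obtain ⟨A, B, C, hA, hB, hC, hAB, hAC, hBC⟩ :=
      Finset.two_lt_card_iff.1 (by omega : 2 < (ls.filter (fun L => v ∈ L)).card)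
    rw [Finset.mem_filter] at hA hB hC
    -- `#(A ∪ B ∪ C) ≤ 7`
    have hAB1 : 1 ≤ (A ∩ B).card := Finset.card_pos.2 ⟨v, Finset.mem_inter.2 ⟨hA.2, hB.2⟩⟩
    have hABC1 : 1 ≤ ((A ∪ B) ∩ C).card :=
      Finset.card_pos.2 ⟨v, Finset.mem_inter.2 ⟨Finset.mem_union_left _ hA.2, hC.2⟩⟩
    have hU7 : (A ∪ B ∪ C).card ≤ 7 := by
      have := Finset.card_union_add_card_inter (A ∪ B) C
      have := Finset.card_union_add_card_inter A B
      have := hcard A hA.1; have := hcard B hB.1; have := hcard C hC.1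
      omega
    by_cases hF : ∃ D ∈ ls, ∃ E ∈ ls, D ≠ E ∧ ¬ D ⊆ A ∪ B ∪ C ∧ ¬ E ⊆ A ∪ B ∪ C
    · -- two lines off `A ∪ B ∪ C`: they share their single point off it, `#P ≤ 8`, every degree `≤ 3`
      obtain ⟨D, hD, E, hE, hDE, hDf, hEf⟩ := hF
      have hallD := all_subset_of_free h1 hcard h3 h4 hA.1 hB.1 hC.1 hD hAB.symm hAC.symm hBC.symm hDf
      have hallE := all_subset_of_free h1 hcard h3 h4 hA.1 hB.1 hC.1 hE hAB.symm hAC.symm hBC.symm hEf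
      have hDU : (D \ (A ∪ B ∪ C)).card ≤ 1 := by
        have hsub : D \ (A ∪ B ∪ C) ⊆ D ∩ E := by
          intro x hx
          rw [Finset.mem_sdiff] at hx
          refine Finset.mem_inter.2 ⟨hx.1, ?_⟩
          have := hallE D hD hx.1
          rw [Finset.mem_union] at this
          exact this.resolve_left hx.2
        exact (Finset.card_le_card hsub).trans (h3 D hD E hE hDE)
      have hP8 : (A ∪ B ∪ C ∪ D).card ≤ 8 := by
        have := Finset.card_sdiff_add_card D (A ∪ B ∪ C)
        rw [Finset.union_comm D] at this
        omega
      have hdeg3 : ∀ u ∈ A ∪ B ∪ C ∪ D, (ls.filter (fun L => u ∈ L)).card ≤ 3 := by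
        intro u hu
        have := two_mul_deg_add_one_le ls (A ∪ B ∪ C ∪ D) u hu (fun L hL => ⟨hcard L hL, hallD L hL⟩) h3
        omega
      have := three_mul_card_le ls (A ∪ B ∪ C ∪ D) 3 (fun L hL => ⟨hcard L hL, hallD L hL⟩) hdeg3
      omega
    · -- at most one line off `A ∪ B ∪ C`: the others are transversals of the six points off `v`
      push Not at hF
      have hF1 : (ls.filter (fun L => ¬ L ⊆ A ∪ B ∪ C)).card ≤ 1 := by
        rw [Finset.card_le_one]
        intro D hD E hE
        rw [Finset.mem_filter] at hD hE
        by_contra hne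
        exact hE.2 (hF D hD.1 E hE.1 hne hD.2)
      set T := ((ls.filter (fun L => L ⊆ A ∪ B ∪ C)).erase A).erase B |>.erase C with hTdef
      have hAin : A ∈ ls.filter (fun L => L ⊆ A ∪ B ∪ C) :=
        Finset.mem_filter.2 ⟨hA.1, Finset.subset_union_left.trans Finset.subset_union_left⟩
      have hBin : B ∈ (ls.filter (fun L => L ⊆ A ∪ B ∪ C)).erase A :=
        Finset.mem_erase.2 ⟨hAB.symm, Finset.mem_filter.2 ⟨hB.1,
          Finset.subset_union_right.trans Finset.subset_union_left⟩⟩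
      have hCin : C ∈ ((ls.filter (fun L => L ⊆ A ∪ B ∪ C)).erase A).erase B :=
        Finset.mem_erase.2 ⟨hBC.symm, Finset.mem_erase.2 ⟨hAC.symm, Finset.mem_filter.2 ⟨hC.1,
          Finset.subset_union_right⟩⟩⟩
      have hTcard : 5 ≤ T.card := by
        have hsplit := Finset.card_filter_add_card_filter_not (s := ls) (p := fun L => L ⊆ A ∪ B ∪ C)
        rw [hTdef, Finset.card_erase_of_mem hCin, Finset.card_erase_of_mem hBin, Finset.card_erase_of_mem hAin]
        omega
      -- the transversals avoid `v`
      have hTmem : ∀ L ∈ T, L ∈ ls ∧ L ⊆ A ∪ B ∪ C ∧ L ≠ A ∧ L ≠ B ∧ L ≠ C := by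
        intro L hL
        rw [hTdef, Finset.mem_erase, Finset.mem_erase, Finset.mem_erase, Finset.mem_filter] at hL
        exact ⟨hL.2.2.2.1, hL.2.2.2.2, hL.2.2.1, hL.2.1, hL.1⟩
      have hTv : ∀ L ∈ T, L ⊆ (A ∪ B ∪ C).erase v := by
        intro L hL x hx
        obtain ⟨hLls, hLU, hLA, hLB, hLC⟩ := hTmem L hL
        rw [Finset.mem_erase]
        refine ⟨?_, hLU hx⟩
        rintro rfl
        -- `x = v ∈ L`: a second point of `L` lies on one of `A, B, C`, which then meets `L` twice
        have h1L : 1 < L.card := by rw [hcard L hLls]; omega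
        obtain ⟨y, hy, hyx⟩ := Finset.exists_mem_ne h1L x
        have hyU := hLU hy
        simp only [Finset.mem_union] at hyU
        have key : ∀ M ∈ ls, M ≠ L → x ∈ M → y ∈ M → False := by
          intro M hM hne hxM hyM
          have hsub : ({y, x} : Finset β) ⊆ L ∩ M := by
            intro z hz
            simp only [Finset.mem_insert, Finset.mem_singleton] at hz
            rcases hz with rfl | rfl
            · exact Finset.mem_inter.2 ⟨hy, hyM⟩
            · exact Finset.mem_inter.2 ⟨hx, hxM⟩
          have h2 := Finset.card_le_card hsub
          rw [Finset.card_pair hyx] at h2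
          have := h3 L hLls M hM (Ne.symm hne)
          omega
        rcases hyU with (hyA | hyB) | hyC
        · exact key A hA.1 (Ne.symm hLA) hA.2 hyA
        · exact key B hB.1 (Ne.symm hLB) hB.2 hyB
        · exact key C hC.1 (Ne.symm hLC) hC.2 hyC
      have hP6 : ((A ∪ B ∪ C).erase v).card ≤ 6 := by
        rw [Finset.card_erase_of_mem (Finset.mem_union_left _ (Finset.mem_union_left _ hA.2))]
        omega
      have hdeg2 : ∀ u ∈ (A ∪ B ∪ C).erase v, (T.filter (fun L => u ∈ L)).card ≤ 2 := by
        intro u hu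
        have := two_mul_deg_add_one_le T ((A ∪ B ∪ C).erase v) u hu
          (fun L hL => ⟨hcard L (hTmem L hL).1, hTv L hL⟩)
          (fun L hL L' hL' hne => h3 L (hTmem L hL).1 L' (hTmem L' hL').1 hne)
        omega
      have := three_mul_card_le T ((A ∪ B ∪ C).erase v) 2
        (fun L hL => ⟨hcard L (hTmem L hL).1, hTv L hL⟩) hdeg2
      omega
  · -- every degree `≤ 2`: `3·#lines ≤ 2·#P ≤ 24`
    push Not at hdeg
    obtain ⟨P, hP, hall⟩ := hP12
    have := three_mul_card_le ls P 2 (fun L hL => ⟨hcard L hL, hall L hL⟩) (fun u _ => by have := hdeg u; omega)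
    omega

end Simple

end FourCap

end S1

end PercRepro
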